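import Mathlib
import Literature.NumberTheory.EllipticCurves.HeegnerPointsOfConductor
import HarnessLib

/-!
# Route `GenusKolyvaginAtTwo`, crux `GenusPrimitiveSupplyAtTwo` (stmt-BirchSwinnertonDyer-22136), line `genus-supply`:
# support P1 / child GI of stub C — «at `p = 2` the Kolyvagin derivative is the genus projector»

The route's rationale and the idea card `genus-kolyvagin-exactness-at-two` (§Mechanism, P1 «support, provable now»):
in `ℤ[G_ℓ]`, `G_ℓ = ⟨σ⟩`, the Kolyvagin derivative `D_ℓ = Σ_{i=1}^{ℓ} i·σ^i` (Gross 1991 §3 (3.5); W. Zhang 2014 §3.7)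
satisfies `D_ℓ ≡ Σ_{i odd} σ^i (mod 2)` and `2·D_ℓ ≡ Tr − Σ (−1)^i σ^i (mod 4)`, because `2i = (1 − (−1)^i) + 4⌊i/2⌋`
for every `i`. This file PROVES these identities in the tree's operator language `KolyvaginOperator.derivOp` ∕
`KolyvaginOperator.derivedPoint` (`HeegnerPointsOfConductor.lean`: a monoid `G` acting on an additive group `A`
through `ρ : G →* AddMonoid.End A`; no group ring), exactly, with the error term explicit:
* `two_mul_natCast_eq_genus` — the integer identity `2i = 1 − (−1)^i + 4·⌊i/2⌋`;
* `two_zsmul_derivOp` — `2·D_ℓ y = (Σ_{i≤ℓ} σ^i y) − (Σ_{i≤ℓ} (−1)^i σ^i y) + 4·Σ_{i≤ℓ} ⌊i/2⌋ σ^i y`;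
  and `derivOp_eq_sum_filter_odd_add_two_zsmul` — `D_ℓ y = Σ_{i odd} σ^i y + 2·Σ ⌊i/2⌋ σ^i y`;
* `two_zsmul_derivedPoint_of_prime` — the same for the derived point `P(ℓ) = Σ_{s∈S} s(D_ℓ y)` at a PRIME level `ℓ`
  (the outer sum over coset representatives commutes with everything);
* `exists_four_zsmul_of_exists_two_zsmul_eq_derivedPoint` ∕ `exists_two_zsmul_eq_derivedPoint_iff` — the DICTIONARY:
  `P(ℓ) ∈ 2A ⟹ Σ_s s(Tr_σ y) − Σ_s s(Y_χ) ∈ 4A`, and conversely when `A[2] = 0` (for `A = E(K[ℓ])` this is Gross's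
  Lemma 4.3 under `ρ̄_{E,2}` onto), where `Tr_σ y = Σ_{i≤ℓ} σ^i y` is the `G_ℓ`-trace when `σ` has order `ℓ + 1`
  (then `= a_ℓ · y_{1}` by the Euler-system norm relation, Gross Prop. 3.7 (1)) and `Y_χ = Σ (−1)^i σ^i y` is the
  genus-character sum (the genus Heegner point of conductor `ℓ` once `ℓ + 1` is even);
* `heegner_two_zsmul_derivedPoint_of_prime` ∕ `heegner_exists_two_zsmul_eq_derivedPoint_iff_of_prime` — the
  instances for the tree's Heegner data `d` of prime conductor `ℓ` (`d.derivedPoint = P(ℓ) ∈ E(K[ℓ])`).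
Pure algebra; no arithmetic input. Helper for the crux item (`--supports stmt-BirchSwinnertonDyer-22136`, helper mode):
it is the first half of stub C's foreseen mechanism («`P(ℓ) ∉ 2E(K[ℓ])` ⟺ `a_ℓ y_K − Y_χ ∉ 4E(K[ℓ])`»). No summit and
no leaf is proved by this file; BSD is not proved by any of this.
-/

set_option linter.dupNamespace false -- tree convention: `Summit.BirchSwinnertonDyer.BirchSwinnertonDyer.Theorems` (summit = sub-problem)

noncomputable section

open scoped Classical

namespace Summit.BirchSwinnertonDyer.BirchSwinnertonDyer.Theorems.GenusKoly

open Finset WeierstrassCurve Literature.NumberTheory.EllipticCurves Literature.NumberTheory.EllipticCurves.ModularForms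
  Literature.NumberTheory.EllipticCurves.KolyvaginOperator

/-! ## §1 The integer identity -/

/-- `2i = (1 − (−1)^i) + 4⌊i/2⌋` in `ℤ` (case split on the parity of `i`): the coefficientwise content of
«`2·D_ℓ ≡ Tr − Σ(−1)^i σ^i (mod 4)`». [folklore] -/
theorem two_mul_natCast_eq_genus (i : ℕ) : (2 * i : ℤ) = 1 - (-1) ^ i + 4 * ((i : ℤ) / 2) := by
  rcases Nat.even_or_odd i with ⟨k, rfl⟩ | ⟨k, rfl⟩
  · rw [Even.neg_one_pow ⟨k, rfl⟩]
    push_cast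
    omega
  · rw [Odd.neg_one_pow ⟨k, rfl⟩]
    push_cast
    omega

/-! ## §2 The operator identity -/

section Operator

variable {G : Type*} [Monoid G] {A : Type*} [AddCommGroup A] (ρ : G →* AddMonoid.End A)

/-- **`2·D_ℓ = Tr − Y_χ + 4·Z`, pointwise**: for a monoid element `σ` acting on an additive group `A` and `y ∈ A`,
`2·D_ℓ y = Σ_{i≤ℓ} σ^i y − Σ_{i≤ℓ} (−1)^i σ^i y + 4·Σ_{i≤ℓ} ⌊i/2⌋ σ^i y`, where `D_ℓ y = Σ_{i≤ℓ} i σ^i y` is the tree's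
`KolyvaginOperator.derivOp` (Gross 1991 §3 (3.5); W. Zhang 2014 §3.7). Termwise `two_mul_natCast_eq_genus`.
[cite: GrossLMS1991, §3 (3.5)] [cite: WZhang2014, §3.7 (D_ℓ)] -/
theorem two_zsmul_derivOp (σ : G) (ℓ : ℕ) (y : A) :
    (2 : ℤ) • derivOp ρ σ ℓ y =
      ∑ i ∈ range (ℓ + 1), ρ (σ ^ i) y - ∑ i ∈ range (ℓ + 1), ((-1 : ℤ) ^ i) • ρ (σ ^ i) y +
        (4 : ℤ) • ∑ i ∈ range (ℓ + 1), (i / 2) • ρ (σ ^ i) y := by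
  simp only [derivOp, Finset.smul_sum, ← Finset.sum_sub_distrib, ← Finset.sum_add_distrib]
  refine Finset.sum_congr rfl fun i _ ↦ ?_
  have key := two_mul_natCast_eq_genus i
  match_scalars
  linear_combination key

/-- **`D_ℓ ≡ genus projector (mod 2)`, exact form**: `D_ℓ y = Σ_{i≤ℓ, i odd} σ^i y + 2·Σ_{i≤ℓ} ⌊i/2⌋ σ^i y`
(`i = (i mod 2) + 2⌊i/2⌋`; «`−1 ≡ 1 (mod 2)` is the whole trick»). [cite: GrossLMS1991, §3 (3.5)] -/
theorem derivOp_eq_sum_filter_odd_add_two_zsmul (σ : G) (ℓ : ℕ) (y : A) :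
    derivOp ρ σ ℓ y =
      ∑ i ∈ (range (ℓ + 1)).filter Odd, ρ (σ ^ i) y +
        (2 : ℤ) • ∑ i ∈ range (ℓ + 1), (i / 2) • ρ (σ ^ i) y := by
  rw [derivOp, Finset.sum_filter, Finset.smul_sum, ← Finset.sum_add_distrib]
  refine Finset.sum_congr rfl fun i _ ↦ ?_
  rcases Nat.even_or_odd i with ⟨k, hk⟩ | ⟨k, hk⟩
  · have hne : ¬ Odd i := Nat.not_odd_iff_even.mpr ⟨k, hk⟩
    have hi : (i : ℤ) = 2 * ((i : ℤ) / 2) := by omega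
    rw [if_neg hne, zero_add]
    match_scalars
    linear_combination hi
  · have hi : (i : ℤ) = 1 + 2 * ((i : ℤ) / 2) := by omega
    rw [if_pos ⟨k, hk⟩]
    match_scalars
    linear_combination hi

/-- **The derived point at a prime level, doubled**: for a prime `ℓ`, `P(ℓ) = Σ_{s∈S} s(D_ℓ y)` (the tree's
`KolyvaginOperator.derivedPoint`, Gross 1991 (4.1), W. Zhang 2014 §3.7 — `D_n` along the prime factors of `n = ℓ` is
`D_ℓ`) satisfies `2·P(ℓ) = Σ_s s(Σ_i σ_ℓ^i y) − Σ_s s(Σ_i (−1)^i σ_ℓ^i y) + 4·Σ_s s(Σ_i ⌊i/2⌋ σ_ℓ^i y)`.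
[cite: GrossLMS1991, §4 (4.1)] [cite: WZhang2014, §3.7 (P(n))] -/
theorem two_zsmul_derivedPoint_of_prime (σ : ℕ → G) {ℓ : ℕ} (hℓ : ℓ.Prime) (S : Finset G) (y : A) :
    (2 : ℤ) • derivedPoint ρ σ ℓ S y =
      ∑ s ∈ S, ρ s (∑ i ∈ range (ℓ + 1), ρ (σ ℓ ^ i) y) -
        ∑ s ∈ S, ρ s (∑ i ∈ range (ℓ + 1), ((-1 : ℤ) ^ i) • ρ (σ ℓ ^ i) y) +
        (4 : ℤ) • ∑ s ∈ S, ρ s (∑ i ∈ range (ℓ + 1), (i / 2) • ρ (σ ℓ ^ i) y) := by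
  rw [derivedPoint, Nat.primeFactorsList_prime hℓ, derivOpProd_cons, derivOpProd_nil, Finset.smul_sum,
    Finset.smul_sum, ← Finset.sum_sub_distrib, ← Finset.sum_add_distrib]
  refine Finset.sum_congr rfl fun s _ ↦ ?_
  rw [← map_zsmul, two_zsmul_derivOp, map_add, map_sub, map_zsmul]

/-- **Dictionary, forward** (no hypothesis on `A`): at a prime level, if `P(ℓ) ∈ 2A` then
`Σ_s s(Tr_σ y) − Σ_s s(Y_χ y) ∈ 4A`, where `Tr_σ y = Σ_{i≤ℓ} σ_ℓ^i y` and `Y_χ y = Σ_{i≤ℓ} (−1)^i σ_ℓ^i y`.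
[cite: GrossLMS1991, §4 (4.1)] -/
theorem exists_four_zsmul_of_exists_two_zsmul_eq_derivedPoint (σ : ℕ → G) {ℓ : ℕ} (hℓ : ℓ.Prime)
    (S : Finset G) (y : A) (h : ∃ Q : A, (2 : ℤ) • Q = derivedPoint ρ σ ℓ S y) :
    ∃ R : A, (4 : ℤ) • R =
      ∑ s ∈ S, ρ s (∑ i ∈ range (ℓ + 1), ρ (σ ℓ ^ i) y) -
        ∑ s ∈ S, ρ s (∑ i ∈ range (ℓ + 1), ((-1 : ℤ) ^ i) • ρ (σ ℓ ^ i) y) := by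
  obtain ⟨Q, hQ⟩ := h
  have h2 := two_zsmul_derivedPoint_of_prime ρ σ hℓ S y
  rw [← hQ] at h2
  exact ⟨Q - ∑ s ∈ S, ρ s (∑ i ∈ range (ℓ + 1), (i / 2) • ρ (σ ℓ ^ i) y),
    by linear_combination (norm := module) h2⟩

/-- **Dictionary, both ways, when `A` has no `2`-torsion** (for `A = E(K[ℓ])`: Gross 1991 Lemma 4.3, «`E` has no
`K_n`-rational `p`-torsion» under `ρ̄_{E,p}` onto): `P(ℓ) ∈ 2A ⟺ Σ_s s(Tr_σ y) − Σ_s s(Y_χ y) ∈ 4A`.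
[cite: GrossLMS1991, §4 (4.1) and Lemma 4.3] -/
theorem exists_two_zsmul_eq_derivedPoint_iff (σ : ℕ → G) {ℓ : ℕ} (hℓ : ℓ.Prime) (S : Finset G) (y : A)
    (htors : ∀ x : A, (2 : ℤ) • x = 0 → x = 0) :
    (∃ Q : A, (2 : ℤ) • Q = derivedPoint ρ σ ℓ S y) ↔
      ∃ R : A, (4 : ℤ) • R =
        ∑ s ∈ S, ρ s (∑ i ∈ range (ℓ + 1), ρ (σ ℓ ^ i) y) -
          ∑ s ∈ S, ρ s (∑ i ∈ range (ℓ + 1), ((-1 : ℤ) ^ i) • ρ (σ ℓ ^ i) y) := by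
  refine ⟨exists_four_zsmul_of_exists_two_zsmul_eq_derivedPoint ρ σ hℓ S y, fun ⟨R, hR⟩ ↦ ?_⟩
  have h2 := two_zsmul_derivedPoint_of_prime ρ σ hℓ S y
  set Z := ∑ s ∈ S, ρ s (∑ i ∈ range (ℓ + 1), (i / 2) • ρ (σ ℓ ^ i) y)
  refine ⟨R + Z, ?_⟩
  -- `2·(2(R+Z) − P(ℓ)) = 4R + 4Z − 2P(ℓ) = 0`, and `A[2] = 0`
  have h0 : (2 : ℤ) • ((2 : ℤ) • (R + Z) - derivedPoint ρ σ ℓ S y) = 0 := by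
    linear_combination (norm := module) hR - h2
  exact sub_eq_zero.mp (htors _ h0)

end Operator

/-! ## §3 The instance for the tree's Heegner data of prime conductor -/

section Heegner

universe u

variable {N : ℕ} [NeZero N] {W : WeierstrassCurve ℚ} {K : Type u} [Field K] [NumberField K]
  {Dt : ModularParametrizationData W N} {β : ℤ} {ι : K →+* ℂ}

/-- **`2·P(ℓ)` for a Kolyvagin–Heegner datum of prime conductor `ℓ`** (Gross 1991 (4.1), W. Zhang 2014 §3.7:
`P(ℓ) = Σ_{s ∈ S} s(D_ℓ y(ℓ)) ∈ E(K[ℓ])`, the tree's `KolyvaginHeegnerData.derivedPoint`): with `σ = d.σ ℓ` the chosen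
generator of `G_ℓ = Gal(K[ℓ]/K[1])` and `Aut(K[ℓ])` acting on `E(K[ℓ])` coordinatewise (`pointGalHom`),
`2·P(ℓ) = Σ_{s∈S} s(Σ_{i≤ℓ} σ^i y(ℓ)) − Σ_{s∈S} s(Σ_{i≤ℓ} (−1)^i σ^i y(ℓ)) + 4·Σ_{s∈S} s(Σ_{i≤ℓ} ⌊i/2⌋ σ^i y(ℓ))`.
The first inner sum is `Tr_{K[ℓ]/K[1]} y(ℓ)` (`σ` has order `ℓ + 1`), `= a_ℓ · y(1)` by the norm relation (Gross
Prop. 3.7 (1)); the second is the genus-character sum `Y_χ`. [cite: GrossLMS1991, §3 Prop. 3.7 (1) and §4 (4.1)]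
[cite: WZhang2014, §3.7 (P(n))] -/
theorem heegner_two_zsmul_derivedPoint_of_prime {ℓ : ℕ} (hℓ : ℓ.Prime)
    (d : KolyvaginHeegnerData Dt β ι ℓ) :
    (2 : ℤ) • d.derivedPoint =
      ∑ s ∈ d.S, pointGalHom W (ringClassField K ι ℓ) s
          (∑ i ∈ range (ℓ + 1), pointGalHom W (ringClassField K ι ℓ) (d.σ ℓ ^ i) d.y) -
        ∑ s ∈ d.S, pointGalHom W (ringClassField K ι ℓ) s
          (∑ i ∈ range (ℓ + 1), ((-1 : ℤ) ^ i) • pointGalHom W (ringClassField K ι ℓ) (d.σ ℓ ^ i) d.y) +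
        (4 : ℤ) • ∑ s ∈ d.S, pointGalHom W (ringClassField K ι ℓ) s
          (∑ i ∈ range (ℓ + 1), (i / 2) • pointGalHom W (ringClassField K ι ℓ) (d.σ ℓ ^ i) d.y) :=
  two_zsmul_derivedPoint_of_prime _ d.σ hℓ d.S d.y

/-- **The genus dictionary for `P(ℓ) ∈ E(K[ℓ])`** when `E(K[ℓ])[2] = 0`: `P(ℓ) ∈ 2E(K[ℓ])` iff
`Σ_s s(Tr_{G_ℓ} y(ℓ)) − Σ_s s(Y_χ) ∈ 4E(K[ℓ])`. (With the norm relation `Tr_{G_ℓ} y(ℓ) = a_ℓ y(1)` the first term is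
`a_ℓ · P(1)`-shaped; for a Kolyvagin prime at `2`, `2 ∣ a_ℓ`.) [cite: GrossLMS1991, §4 (4.1) and Lemma 4.3] -/
theorem heegner_exists_two_zsmul_eq_derivedPoint_iff_of_prime {ℓ : ℕ} (hℓ : ℓ.Prime)
    (d : KolyvaginHeegnerData Dt β ι ℓ)
    (htors : ∀ P : (W.baseChange (ringClassField K ι ℓ)).toAffine.Point, (2 : ℤ) • P = 0 → P = 0) :
    (∃ Q : (W.baseChange (ringClassField K ι ℓ)).toAffine.Point, (2 : ℤ) • Q = d.derivedPoint) ↔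
      ∃ R : (W.baseChange (ringClassField K ι ℓ)).toAffine.Point, (4 : ℤ) • R =
        ∑ s ∈ d.S, pointGalHom W (ringClassField K ι ℓ) s
            (∑ i ∈ range (ℓ + 1), pointGalHom W (ringClassField K ι ℓ) (d.σ ℓ ^ i) d.y) -
          ∑ s ∈ d.S, pointGalHom W (ringClassField K ι ℓ) s
            (∑ i ∈ range (ℓ + 1), ((-1 : ℤ) ^ i) • pointGalHom W (ringClassField K ι ℓ) (d.σ ℓ ^ i) d.y) :=
  exists_two_zsmul_eq_derivedPoint_iff _ d.σ hℓ d.S d.y htors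

end Heegner

/-! ## §4 (APPEND 1, same seat) Mod `2` at ANY square-free level: `D_n ≡ ∏_ℓ Σ_{i odd} σ_ℓ^i`, `P(n) ≡ G(n)`

The card's headline identity `D_ℓ ≡ Σ_{i odd} σ^i (mod 2)` in PRODUCT form along the prime factors of a level `n`
(Gross 1991 §3 «`D_n = ∏ D_ℓ`»; W. Zhang 2014 §3.7), with no hypothesis on `A` and no commutativity: the Kolyvagin
derivative `D_n y` and the «odd-part» operator `∏_ℓ (Σ_{i odd ≤ ℓ} σ_ℓ^i)` applied to `y` (written as a `List.foldr` over
`n.primeFactorsList`, no new definition) differ by an element of `2A`, because each `D_ℓ` does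
(`derivOp_eq_sum_filter_odd_add_two_zsmul`) and each `D_ℓ` is additive. Consequently the derived point
`P(n) = Σ_{s∈S} s(D_n y)` is congruent mod `2A` to the GENUS-TYPE POINT `G(n) = Σ_{s∈S} s(∏_ℓ Σ_{i odd} σ_ℓ^i · y)`, and
`P(n) ∈ 2A ⟺ G(n) ∈ 2A` (`exists_two_zsmul_eq_derivedPoint_iff_oddPart`) — the registered stub C
(`stub_genusPrimitivityAtTwo`: «some `P(n) ∉ 2E(K[n])`») is thereby EQUIVALENT to «some `G(n) ∉ 2E(K[n])`». For odd `ℓ`,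
`Σ_{i odd ≤ ℓ} σ^i = σ · Σ_{k < (ℓ+1)/2} (σ²)^k` (`sum_filter_odd_eq_map_sum_sq_pow`): when `σ` generates `G_ℓ` (order
`ℓ + 1`) the inner sum is the NORM from `K[ℓ]` to the fixed field of `σ²`, the quadratic («genus») layer over
`K[n/ℓ]`. -/

section OddPart

variable {G : Type*} [Monoid G] {A : Type*} [AddCommGroup A] (ρ : G →* AddMonoid.End A)

/-- `D_ℓ` commutes with integer scalars (it is a sum of additive maps). [folklore] -/
theorem derivOp_zsmul (σ : G) (ℓ : ℕ) (m : ℤ) (y : A) : derivOp ρ σ ℓ (m • y) = m • derivOp ρ σ ℓ y := by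
  simp only [derivOp, map_zsmul, Finset.smul_sum, smul_comm m]

/-- `D_ℓ` is additive. [folklore] -/
theorem derivOp_add (σ : G) (ℓ : ℕ) (y y' : A) : derivOp ρ σ ℓ (y + y') = derivOp ρ σ ℓ y + derivOp ρ σ ℓ y' := by
  simp only [derivOp, map_add, smul_add, Finset.sum_add_distrib]

/-- **`D_L ≡ ∏_{ℓ ∈ L} (Σ_{i odd ≤ ℓ} σ_ℓ^i) (mod 2A)`** along any list of levels (Gross 1991 §3: `D_n = ∏ D_ℓ`): induction on
the list with `derivOp_eq_sum_filter_odd_add_two_zsmul`, `derivOp_add`, `derivOp_zsmul`.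
[cite: GrossLMS1991, §3 (3.5) and (D_n = ∏ D_ℓ)] -/
theorem exists_derivOpProd_eq_oddPart_add_two_zsmul (σ : ℕ → G) (L : List ℕ) (y : A) :
    ∃ z : A, derivOpProd ρ σ L y =
      L.foldr (fun ℓ x ↦ ∑ i ∈ (range (ℓ + 1)).filter Odd, ρ (σ ℓ ^ i) x) y + (2 : ℤ) • z := by
  induction L with
  | nil => exact ⟨0, by simp⟩
  | cons ℓ L ih =>
    obtain ⟨z, hz⟩ := ih
    set x := L.foldr (fun ℓ x ↦ ∑ i ∈ (range (ℓ + 1)).filter Odd, ρ (σ ℓ ^ i) x) y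
    refine ⟨(∑ i ∈ range (ℓ + 1), (i / 2) • ρ (σ ℓ ^ i) x) + derivOp ρ (σ ℓ) ℓ z, ?_⟩
    rw [derivOpProd_cons, hz, List.foldr_cons, derivOp_add, derivOp_zsmul,
      derivOp_eq_sum_filter_odd_add_two_zsmul, smul_add, add_assoc]

/-- **`P(n) ≡ G(n) (mod 2A)`**: the derived point `P(n) = Σ_{s∈S} s(D_n y)` (Gross 1991 (4.1); W. Zhang 2014 §3.7) and
the genus-type point `G(n) = Σ_{s∈S} s(∏_{ℓ ∣ n} (Σ_{i odd ≤ ℓ} σ_ℓ^i) y)` differ by an element of `2A`.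
[cite: GrossLMS1991, §4 (4.1)] [cite: WZhang2014, §3.7 (P(n))] -/
theorem exists_derivedPoint_eq_oddPart_add_two_zsmul (σ : ℕ → G) (n : ℕ) (S : Finset G) (y : A) :
    ∃ z : A, derivedPoint ρ σ n S y =
      ∑ s ∈ S, ρ s (n.primeFactorsList.foldr (fun ℓ x ↦ ∑ i ∈ (range (ℓ + 1)).filter Odd, ρ (σ ℓ ^ i) x) y) +
        (2 : ℤ) • z := by
  obtain ⟨z, hz⟩ := exists_derivOpProd_eq_oddPart_add_two_zsmul ρ σ n.primeFactorsList y
  refine ⟨∑ s ∈ S, ρ s z, ?_⟩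
  rw [derivedPoint, hz, Finset.smul_sum, ← Finset.sum_add_distrib]
  exact Finset.sum_congr rfl fun s _ ↦ by rw [map_add, map_zsmul]

/-- **`P(n) ∈ 2A ⟺ G(n) ∈ 2A`** at every level `n`, with NO hypothesis on `A`: Kolyvagin `2`-primitivity of the derived
Heegner point is `2`-primitivity of the genus-type point. [cite: GrossLMS1991, §4 (4.1)] -/
theorem exists_two_zsmul_eq_derivedPoint_iff_oddPart (σ : ℕ → G) (n : ℕ) (S : Finset G) (y : A) :
    (∃ Q : A, (2 : ℤ) • Q = derivedPoint ρ σ n S y) ↔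
      ∃ Q : A, (2 : ℤ) • Q =
        ∑ s ∈ S, ρ s (n.primeFactorsList.foldr (fun ℓ x ↦ ∑ i ∈ (range (ℓ + 1)).filter Odd, ρ (σ ℓ ^ i) x) y) := by
  obtain ⟨z, hz⟩ := exists_derivedPoint_eq_oddPart_add_two_zsmul ρ σ n S y
  constructor
  · rintro ⟨Q, hQ⟩
    exact ⟨Q - z, by rw [smul_sub, hQ, hz, add_sub_cancel_right]⟩
  · rintro ⟨Q, hQ⟩
    exact ⟨Q + z, by rw [smul_add, hQ, hz]⟩

/-- **`Σ_{i odd ≤ ℓ} σ^i = σ · Σ_{k < (ℓ+1)/2} (σ²)^k`** (reindex `i = 2k + 1`; any `ℓ`): for odd `ℓ` the odd part of `D_ℓ`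
is `σ` times the norm element of `⟨σ²⟩`, the index-`2` subgroup of `G_ℓ = ⟨σ⟩` when `σ` has even order `ℓ + 1`.
[folklore] -/
theorem sum_filter_odd_eq_map_sum_sq_pow (σ : G) (ℓ : ℕ) (x : A) :
    ∑ i ∈ (range (ℓ + 1)).filter Odd, ρ (σ ^ i) x = ρ σ (∑ k ∈ range ((ℓ + 1) / 2), ρ ((σ ^ 2) ^ k) x) := by
  rw [map_sum]
  have himage : (range (ℓ + 1)).filter Odd = (range ((ℓ + 1) / 2)).image (fun k ↦ 2 * k + 1) := by
    ext i
    simp only [Finset.mem_filter, Finset.mem_range, Finset.mem_image]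
    constructor
    · rintro ⟨hi, ⟨k, rfl⟩⟩
      exact ⟨k, by omega, rfl⟩
    · rintro ⟨k, hk, rfl⟩
      exact ⟨by omega, ⟨k, rfl⟩⟩
  rw [himage, Finset.sum_image (fun a _ b _ h ↦ by omega)]
  refine Finset.sum_congr rfl fun k _ ↦ ?_
  rw [← pow_mul, pow_succ', map_mul]
  rfl

end OddPart

section HeegnerOddPart

universe u

variable {N : ℕ} [NeZero N] {W : WeierstrassCurve ℚ} {K : Type u} [Field K] [NumberField K]
  {Dt : ModularParametrizationData W N} {β : ℤ} {ι : K →+* ℂ}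

/-- **`P(n) ∈ 2E(K[n]) ⟺ G(n) ∈ 2E(K[n])`** for the tree's Kolyvagin–Heegner datum of any conductor `n`
(`d.derivedPoint = P(n)`): the registered stub C of line `genus-supply` («some `P(n) ∉ 2E(K[n])`») is equivalent to the
non-`2`-divisibility of some genus-type point `G(n) = Σ_{s∈S} s(∏_{ℓ∣n} Σ_{i odd} σ_ℓ^i · y(n))`.
[cite: GrossLMS1991, §4 (4.1)] [cite: WZhang2014, §3.7 (P(n))] -/
theorem heegner_exists_two_zsmul_eq_derivedPoint_iff_oddPart {n : ℕ} (d : KolyvaginHeegnerData Dt β ι n) :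
    (∃ Q : (W.baseChange (ringClassField K ι n)).toAffine.Point, (2 : ℤ) • Q = d.derivedPoint) ↔
      ∃ Q : (W.baseChange (ringClassField K ι n)).toAffine.Point, (2 : ℤ) • Q =
        ∑ s ∈ d.S, pointGalHom W (ringClassField K ι n) s
          (n.primeFactorsList.foldr
            (fun ℓ x ↦ ∑ i ∈ (range (ℓ + 1)).filter Odd, pointGalHom W (ringClassField K ι n) (d.σ ℓ ^ i) x) d.y) :=
  exists_two_zsmul_eq_derivedPoint_iff_oddPart _ d.σ n d.S d.y

end HeegnerOddPart

end Summit.BirchSwinnertonDyer.BirchSwinnertonDyer.Theorems.GenusKoly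

end
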